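import Mathlib
import Summits.MatrixMultiplication.MatrixMultiplication.Theorems.SnSubsetDichotomyHyperoctahedralThresholdRotationIdentity

/-!
# The family of twin pre-pairs avoiding a vertex set is rotation-closed
(crux `SnSubsetDichotomy.HyperoctahedralThreshold`, stmt-MatrixMultiplication-10883; siege seat k18, variation "twins ℓ² argument";
`--supports` helper, companion of `…TwinDefectsLocal` (p116667) and `…TwinsEll2Local` (p116368))

Vocabulary of the line: involutions `μ c` of `Fin n`, `x · z := z.foldl (fun v c => μ c v) x`, cyclically reduced words of length `ℓ` as the
filtered image of `List.Vector (Fin 3) ℓ`.  For a vertex set `D` (forbidden set ∪ dense vertices ∪ scars, …) let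
`P'_D := {(z, x, y) : z cyclically reduced of length ℓ, x ≠ y fixed by z, x · z.take i ∉ D and y · z.take i ∉ D for all i < ℓ}`
— the twin pre-pairs of length `ℓ` whose two trajectories AVOID `D`.  This file proves the two hypotheses of the local twins ℓ² reduction
(`stub_twinsEll2LocalRot`: `…TwinDefectsLocal` + `…TwinsEll2Local`) for `P'_D`:
* `avoidFamily_mem` — members are twin pre-pairs of length `ℓ` (`hP'`);
* `avoidFamily_rot` — `P'_D` is ROTATION-CLOSED: `(z.rotate s, x · z.take s, y · z.take s) ∈ P'_D` for `s < ℓ` (`hrot`), because the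
  trajectory of the rotated pre-pair is the same point set read from time `s` (periodicity of the trajectory of a fixed point).
Consequently (composition left to the file importing the three modules) the R-form of the open core follows, with `R := D`, from
`ℓ · (Ret₁ + Ret₂ + Ξ)(P'_D) < |P'_D|` — returns and slides counted INSIDE the `D`-avoiding family, the `D`-based terms being zero.
Pure finite combinatorics; hypothesis `μ c * μ c = 1`; no definitions.
-/

set_option linter.dupNamespace false

namespace Summit.MatrixMultiplication.MatrixMultiplication.Theorems.HyperoctahedralThreshold

namespace TwinsEll2

open Finset Rotation

variable {n : ℕ}

/-- **Members of the avoiding family are twin pre-pairs of length `ℓ`.** -/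
theorem avoidFamily_mem (μ : Fin 3 → Equiv.Perm (Fin n)) (D : Finset (Fin n)) (ℓ : ℕ) :
    ∀ t ∈ ((((univ : Finset (List.Vector (Fin 3) ℓ)).image (fun v => v.toList)).filter
        (fun z => List.IsChain (· ≠ ·) (z ++ z))) ×ˢ (univ : Finset (Fin n)) ×ˢ (univ : Finset (Fin n))).filter
        (fun t => t.1.foldl (fun v c => μ c v) t.2.1 = t.2.1 ∧ t.1.foldl (fun v c => μ c v) t.2.2 = t.2.2 ∧ t.2.1 ≠ t.2.2 ∧
          ∀ i < ℓ, (t.1.take i).foldl (fun v c => μ c v) t.2.1 ∉ D ∧ (t.1.take i).foldl (fun v c => μ c v) t.2.2 ∉ D),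
      t.1.length = ℓ ∧ List.IsChain (· ≠ ·) (t.1 ++ t.1) ∧ t.1.foldl (fun v c => μ c v) t.2.1 = t.2.1 ∧
        t.1.foldl (fun v c => μ c v) t.2.2 = t.2.2 ∧ t.2.1 ≠ t.2.2 := by
  rintro ⟨z, x, y⟩ h
  rw [mem_filter] at h
  obtain ⟨hmem, hx, hy, hxy, -⟩ := h
  simp only [mem_product, mem_univ, and_true] at hmem
  exact ⟨(mem_cycWords.1 hmem).1, (mem_cycWords.1 hmem).2, hx, hy, hxy⟩

/-- **The avoiding family is rotation-closed.**  For `(z, x, y) ∈ P'_D` and `s < ℓ`, the rotated pre-pair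
`(z.rotate s, x · z.take s, y · z.take s)` lies in `P'_D`: its `i`-th trajectory points are the `((s + i) % ℓ)`-th trajectory points
of `(z, x, y)`. -/
theorem avoidFamily_rot (μ : Fin 3 → Equiv.Perm (Fin n)) (hμ : ∀ c, μ c * μ c = 1) (D : Finset (Fin n)) (ℓ : ℕ) :
    ∀ t ∈ ((((univ : Finset (List.Vector (Fin 3) ℓ)).image (fun v => v.toList)).filter
        (fun z => List.IsChain (· ≠ ·) (z ++ z))) ×ˢ (univ : Finset (Fin n)) ×ˢ (univ : Finset (Fin n))).filter
        (fun t => t.1.foldl (fun v c => μ c v) t.2.1 = t.2.1 ∧ t.1.foldl (fun v c => μ c v) t.2.2 = t.2.2 ∧ t.2.1 ≠ t.2.2 ∧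
          ∀ i < ℓ, (t.1.take i).foldl (fun v c => μ c v) t.2.1 ∉ D ∧ (t.1.take i).foldl (fun v c => μ c v) t.2.2 ∉ D),
      ∀ s < ℓ, ((t.1.rotate s, (t.1.take s).foldl (fun v c => μ c v) t.2.1, (t.1.take s).foldl (fun v c => μ c v) t.2.2) :
          List (Fin 3) × Fin n × Fin n) ∈
        ((((univ : Finset (List.Vector (Fin 3) ℓ)).image (fun v => v.toList)).filter
        (fun z => List.IsChain (· ≠ ·) (z ++ z))) ×ˢ (univ : Finset (Fin n)) ×ˢ (univ : Finset (Fin n))).filter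
        (fun t => t.1.foldl (fun v c => μ c v) t.2.1 = t.2.1 ∧ t.1.foldl (fun v c => μ c v) t.2.2 = t.2.2 ∧ t.2.1 ≠ t.2.2 ∧
          ∀ i < ℓ, (t.1.take i).foldl (fun v c => μ c v) t.2.1 ∉ D ∧ (t.1.take i).foldl (fun v c => μ c v) t.2.2 ∉ D) := by
  -- trajectory along a rotated word (the statement of `TwinsEll2.foldl_take_rotate` of `…TwinDefects`, proved inline)
  have key : ∀ {z : List (Fin 3)} {y : Fin n}, z.foldl (fun v c => μ c v) y = y → ∀ {s e : ℕ}, s < z.length → e < z.length →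
      ((z.rotate s).take e).foldl (fun v c => μ c v) ((z.take s).foldl (fun v c => μ c v) y) =
        (z.take ((s + e) % z.length)).foldl (fun v c => μ c v) y := by
    intro z y hy s e hs he
    rw [← List.foldl_append, List.rotate_eq_drop_append_take hs.le, List.take_append, List.length_drop,
      List.take_take, ← List.append_assoc, ← List.take_add]
    rcases lt_or_ge (s + e) z.length with h | h
    · have h1 : min (e - (z.length - s)) s = 0 := by omega
      rw [h1, List.take_zero, List.append_nil, Nat.mod_eq_of_lt h]
    · have h1 : min (e - (z.length - s)) s = s + e - z.length := by omega
      have h2 : (s + e) % z.length = s + e - z.length := by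
        rw [Nat.mod_eq_sub_mod h, Nat.mod_eq_of_lt (by omega)]
      rw [h1, h2, List.foldl_append, List.take_of_length_le h, hy]
  rintro ⟨z, x, y⟩ h s hs
  rw [mem_filter] at h
  obtain ⟨hmem, hx, hy, hxy, havoid⟩ := h
  simp only [mem_product, mem_univ, and_true] at hmem
  dsimp only at hx hy hxy havoid
  have hzl : z.length = ℓ := (mem_cycWords.1 hmem).1
  have hℓ : 0 < ℓ := by omega
  rw [mem_filter]
  simp only [mem_product, mem_univ, and_true]
  refine ⟨rotate_mem_cycWords hmem s, (foldl_rotate_fixed_iff μ hμ (by omega) x).2 hx,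
    (foldl_rotate_fixed_iff μ hμ (by omega) y).2 hy, fun h => hxy (foldl_act_injective μ hμ (z.take s) h), ?_⟩
  intro i hi
  have hmod : (s + i) % ℓ < ℓ := Nat.mod_lt _ hℓ
  rw [key hx (by omega) (by omega), key hy (by omega) (by omega), hzl]
  exact havoid _ hmod

/-- **Registered form** (`stub_twinAvoidFamilyRot`, a `--supports` sub-goal of crux stmt-MatrixMultiplication-10883): the family of twin
pre-pairs of length `ℓ` whose trajectories avoid `D` is rotation-closed (`avoidFamily_rot`, fully quantified). -/
theorem stub_twinAvoidFamilyRot : ∀ (n ℓ : ℕ) (μ : Fin 3 → Equiv.Perm (Fin n)) (D : Finset (Fin n)), (∀ c, μ c * μ c = 1) → ∀ t ∈ (((((Finset.univ : Finset (List.Vector (Fin 3) ℓ)).image (fun v => v.toList)).filter (fun z => List.IsChain (· ≠ ·) (z ++ z))) ×ˢ (Finset.univ : Finset (Fin n)) ×ˢ (Finset.univ : Finset (Fin n))).filter (fun t => t.1.foldl (fun v c => μ c v) t.2.1 = t.2.1 ∧ t.1.foldl (fun v c => μ c v) t.2.2 = t.2.2 ∧ t.2.1 ≠ t.2.2 ∧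 ∀ i < ℓ, (t.1.take i).foldl (fun v c => μ c v) t.2.1 ∉ D ∧ (t.1.take i).foldl (fun v c => μ c v) t.2.2 ∉ D)), ∀ s < ℓ, ((t.1.rotate s, (t.1.take s).foldl (fun v c => μ c v) t.2.1, (t.1.take s).foldl (fun v c => μ c v) t.2.2) : List (Fin 3) × Fin n × Fin n) ∈ (((((Finset.univ : Finset (List.Vector (Fin 3) ℓ)).image (fun v => v.toList)).filter (fun z => List.IsChain (· ≠ ·) (z ++ z))) ×ˢ (Finset.univ : Finset (Fin n)) ×ˢ (Finset.univ : Finset (Fin n))).filter (fun t => t.1.foldl (fun v c => μ c v) t.2.1 = t.2.1 ∧ t.1.foldl (fun v c => μ c v) t.2.2 = t.2.2 ∧ t.2.1 ≠ t.2.2 ∧ ∀ i < ℓ, (t.1.take i).foldl (fun v c => μ c v) t.2.1 ∉ D ∧ (t.1.take i).foldl (fun v c => μ c v) t.2.2 ∉ D)) :=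
  fun _ ℓ μ D hμ => avoidFamily_rot μ hμ D ℓ

end TwinsEll2

end Summit.MatrixMultiplication.MatrixMultiplication.Theorems.HyperoctahedralThreshold
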